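/-
Origin: expansion seat `planner-pub-hodgecm-mc-axioms-1-g14-0`, handover #W228 2026-08-20T15:53:55Z md5 d9572af92d3c (PKG 18bfb32e81df → d9572af92d3c; 192 l.; MECHANICAL (iib-R) rewrite v3.1 of the PKG file as it stands (7 token edits; rules R1x1+RX[h₂]x6)) (`HOME/mc/pub-hodgecm-mc-axioms-1-g14/revendor/kit-r55/stage55/HodgeCM/Model/Binders/Real34LocOfThetaGen.lean`, md5 d9572af92d3c, 192 lines);
landed by the gen-22 packager (p-g22) in gate run 55 REPLACES the earlier landed copy of `HodgeCM/Model/Binders/Real34LocOfThetaGen.lean` (seat copy carried the packager Origin header of an earlier run (stripped)).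
-/
/-
Origin: speedrun cell pub-hodgecm, MODEL-CONSTRUCTION sub-cell, unit pub-hodgecm-mc-binder-1-g8 (BINDER PROVER, gen 8; node
B2-meet, BINDER-OWNERS row 15 `real34`, junction record `Real34Loc` of kit #14 r3), seat prover-pub-hodgecm-mc-binder-1-g8-0, 2026-08-19.
(W1) REVISION ⁗ (RUN 37): token `levelOf (Level.isCongruenceSubgroup_coe Γ)` ↦ `Γ.K` (2 sites in `htransl`).
Target in PKG: HodgeCM/Model/Binders/Real34LocOfThetaGen.lean (NEW additive leaf; imports this lineage's kit rows #14 r3 `Model/Binders/Real34Meet`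
(‴ world) and #10 r3 `Model/Binders/Gen12RepOfSat`; nothing landed imports it).
PURPOSE (model1 BINDER-TRIAGE §66 (D), condition (1)): the record `Real34Loc {Rep, sat, transl, descend}` is INSTANTIATED at
`Rep Γ i G := G ∈ span (thetaGen Γ i (adm Γ i))` and its three fields are DISCHARGED from four hypotheses in the THETA LANE'S vocabulary
(per `K`-type situation, per generating theta form): `hsat` (admissible ⇒ saturated at `satSubgroup Γ`; definitional at the (Θ-sat) pin),
`hΘge` (admissible situations' restricted forms lie in the pin's classical theta space; `forms_le_thetaSpaceOf` at the v2 pin, definitional at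
the (Θ-sat) pin), `hhol` (restricted theta forms of admissible situations are holomorphic — theta-3's `ThetaHol*` export) and `htransl`
(finite-adelic translates of generating theta forms of admissible situations are admissible generating theta forms at the conjugated level —
theta-3, tree `rightTranslateHom_thetaForm` / `map_rightTranslateHom_thetaForms_le`).  So nothing record-typed reaches E.
KERNEL ONLY: 0 records of published theorems, nothing cited, 0 `def … : Prop`, MODEL-N ±0, E unchanged.
-/
import Summits.HodgeConjecture.HodgeCM.Model.Binders.Real34Meet
import Summits.HodgeConjecture.HodgeCM.Model.Binders.Gen12RepOfSat

/-!
# Row `real34`: the junction record `Real34Loc` at `Rep := span thetaGen`, fields discharged from theta-lane exports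

* § 1 linearity of `QuotientModel.rTranslate₂` in the function.
* § 2 **`Real34Loc.ofThetaGen adm hsat hΘge hhol htransl : Real34Loc …`** with `Rep Γ i G := G ∈ span (thetaGen Γ i (adm Γ i))`:
  `sat` ⟸ kit #10 `apply_mul_eq_of_saturated` + span induction; `transl` ⟸ `htransl` on generators + § 1; `descend` ⟸ span induction producing
  `F ∈ (𝕏).Θ i Γ ⊓ Hol` with `F = G ∘ ιinf` (`hΘge`, `hhol`), then `ClassMapDatum.descends` + `mem_thetaClasses_of_pull_eq` + `Gen12Junctions.theta_eq`.
Nothing here is a claim of the manuscripts under adjudication.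
-/

set_option autoImplicit false

noncomputable section

open MeasureTheory NumberField
open scoped InnerProductSpace

namespace HodgeCM

namespace QuotientModel

variable (Q : QuotientModel)

/-! ## 1. `rTranslate₂` is linear in the function -/

/-- (Ported verbatim from the HodgeCMPerL package; no docstring in the source.) -/
theorem rTranslate₂_add (F F' : Q.leftInvCont₂) (a : Q.G) :
    Q.rTranslate₂ (F + F') a = Q.rTranslate₂ F a + Q.rTranslate₂ F' a :=
  Subtype.ext (funext fun _ => rfl)

/-- (Ported verbatim from the HodgeCMPerL package; no docstring in the source.) -/
theorem rTranslate₂_smul (r : ℂ) (F : Q.leftInvCont₂) (a : Q.G) :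
    Q.rTranslate₂ (r • F) a = r • Q.rTranslate₂ F a :=
  Subtype.ext (funext fun _ => rfl)

/-- (Ported verbatim from the HodgeCMPerL package; no docstring in the source.) -/
theorem rTranslate₂_zero (a : Q.G) : Q.rTranslate₂ 0 a = 0 :=
  Subtype.ext (funext fun _ => rfl)

/-- Right translates preserve spans: if every generator's translate lies in a submodule `M`, so does the translate of every element of the span. -/
theorem rTranslate₂_mem_of_span {A : Set Q.leftInvCont₂} {M : Submodule ℂ Q.leftInvCont₂} (a : Q.G)
    (h : ∀ F ∈ A, Q.rTranslate₂ F a ∈ M) {F : Q.leftInvCont₂} (hF : F ∈ Submodule.span ℂ A) :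
    Q.rTranslate₂ F a ∈ M := by
  induction hF using Submodule.span_induction with
  | mem x hx => exact h x hx
  | zero => rw [rTranslate₂_zero]; exact M.zero_mem
  | add x y _ _ hx hy => rw [rTranslate₂_add]; exact M.add_mem hx hy
  | smul r x _ hx => rw [rTranslate₂_smul]; exact M.smul_mem r hx

end QuotientModel

namespace Model

open HodgeCM HodgeCM.Universe
open Literature.NumberTheory.Weil1964
open Literature.NumberTheory.Automorphic (weightForms)
open Literature.NumberTheory.Automorphic.WeightForms (ClassMapDatum thetaClasses restrictHom IsLevelCorrected IsWeightMatched
  mem_thetaClasses_of_pull_eq)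
open Literature.NumberTheory.Automorphic.LevelOrbit (conjLevel)
open Literature.NumberTheory.Automorphic.UnitaryGroup
open Literature.AlgebraicGeometry.HodgeTheory
open Literature.NumberTheory.Automorphic.PicardCM
open Literature.NumberTheory.Transcendental (Arapura2012_Cor_15_4_6)
open HodgeCM.Model.ThetaSpace

variable (hHD : exists_isReal_hodgeModel) (hI : hodgePQ_independent_of_hodgeModel)
  (h₁ : BallQuotientUniformised)  (h₃ : CMAbelianVarietyRealised)
variable (h : Bool) (hA : Arapura2012_Cor_15_4_6)
  (W : ∀ {L : CMField} {ι₁ : L →+* ℂ} (V : HermSpace3 L ι₁) (c : SeesawCtx L), WmInput V c.D)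
  (S : ∀ {L : CMField} {ι₁ : L →+* ℂ} (V : HermSpace3 L ι₁) (c : SeesawCtx L), ThetaAdelicSide V c)
  (μ : ∀ {L : CMField}, SeesawCtx L → Fin 4 → InfinitePlace L → ℤ)
variable {L : CMField} {ι₁ : L →+* ℂ} (V : HermSpace3 L ι₁) (c : SeesawCtx L) (hV : IsAnisotropic L V.Hm)

/-- the pinned theta-space INPUT of the context (kit #2 `pinX`) -/
local notation3 "𝕏" => pinX hHD hI h₁ h₃ S V c hV

/-! ## 2. The record at `Rep := span thetaGen`, fields discharged -/

/-- **`Real34Loc` at `Rep Γ i G := G ∈ span (thetaGen Γ i (adm Γ i))`**, its three junction fields DISCHARGED from four theta-lane exports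
stated per admissible `K`-type situation: `hsat` (saturation at `satSubgroup Γ`), `hΘge` (restricted forms lie in the pin's classical theta
space), `hhol` (restricted theta forms are holomorphic, i.e. lie in `((𝕏).D Γ).Hol`), `htransl` (the finite-adelic translate by `e(1, k_f⁻¹)` of a
theta form of an admissible situation at `Γ'` lies, as a function on `G_U(𝔸)`, in `span (thetaGen Γ k (adm Γ k))` whenever `K_Γ ≤ k_f⁻¹ K_{Γ'} k_f`). -/
def Real34Loc.ofThetaGen
    (adm : ∀ (Γ : Level V) (k : Fin 4),
      KTypeSituation ((𝕏).P k) ((𝕏).ιinf Γ) ((𝕏).Δ Γ) (𝕏).κ₁ (𝕏).τ₁ → Prop)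
    (hsat : ∀ (Γ : Level V) (k : Fin 4) (Sit : KTypeSituation ((𝕏).P k) ((𝕏).ιinf Γ) ((𝕏).Δ Γ) (𝕏).κ₁ (𝕏).τ₁),
      adm Γ k Sit → ∀ g ∈ satSubgroup V hV Γ, ∃ c' : Sit.Kc, Sit.κ c' = g ∧ Sit.τ c' = 1)
    (hΘge : ∀ (Γ : Level V) (k : Fin 4) (Sit : KTypeSituation ((𝕏).P k) ((𝕏).ιinf Γ) ((𝕏).Δ Γ) (𝕏).κ₁ (𝕏).τ₁),
      adm Γ k Sit → Sit.forms ((𝕏).P k).weightFunctions ≤ (𝕏).Θ k Γ)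
    (hhol : ∀ (Γ : Level V) (k : Fin 4) (Sit : KTypeSituation ((𝕏).P k) ((𝕏).ιinf Γ) ((𝕏).Δ Γ) (𝕏).κ₁ (𝕏).τ₁),
      adm Γ k Sit → ∀ θ ∈ Sit.thetaForms ((𝕏).P k).weightFunctions,
        restrictHom ((𝕏).ιinf Γ) Sit.hΔ Sit.hη θ ∈ ((𝕏).D Γ).Hol)
    (htransl : ∀ (Γ' Γ : Level V) (k : Fin 4) (Sit : KTypeSituation ((𝕏).P k) ((𝕏).ιinf Γ') ((𝕏).Δ Γ') (𝕏).κ₁ (𝕏).τ₁)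
        (kf : finAdelic (↥(maximalRealSubfield L)) L (IsCMField.complexConj L) 3 V.Hm),
      adm Γ' k Sit →
      Γ.K ≤ conjLevel Γ'.K kf⁻¹ →
      ∀ θ ∈ Sit.thetaForms ((𝕏).P k).weightFunctions,
        ∃ G ∈ Submodule.span ℂ (thetaGen hHD hI h₁ h₃ S V c hV Γ k (adm Γ k)),
          (G : (quotU V).G → (Fin 2 → ℂ)) =
            fun g : (quotU V).G => (θ : (𝕏).GU → (𝕏).W)
              ((g * regimeEquivT V hV ((cmAdelicProdEquiv (L : Type) 3 V.Hm).symm (1, kf⁻¹)) : (quotU V).G))) :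
    Real34Loc hHD hI h₁ h₃ h hA W S μ V c hV where
  Rep Γ i G := G ∈ Submodule.span ℂ (thetaGen hHD hI h₁ h₃ S V c hV Γ i (adm Γ i))
  sat Γ i G hG := by
    -- span induction: generators are theta forms of saturated situations (kit #10 `apply_mul_eq_of_saturated`)
    induction hG using Submodule.span_induction with
    | mem x hx =>
      obtain ⟨Sit, hadm, j, hj, f, hf, hx⟩ := hx
      intro g k' hk'
      rw [hx]
      exact apply_mul_eq_of_saturated hHD hI h₁ h₃ S V c hV Sit (hsat Γ i Sit hadm) _ g hk'
    | zero => intro g k' _; rfl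
    | add x y _ _ hx hy =>
      intro g k' hk'
      simp only [Submodule.coe_add, Pi.add_apply, hx g k' hk', hy g k' hk']
    | smul r x _ hx =>
      intro g k' hk'
      simp only [Submodule.coe_smul, Pi.smul_apply, hx g k' hk']
  transl Γ' Γ i G kf hG hK := by
    refine (quotU V).rTranslate₂_mem_of_span _ (fun F hF => ?_) hG
    obtain ⟨Sit, hadm, j, hj, f, hf, hF⟩ := hF
    have hθ : ((𝕏).P i).kernelDatum.thetaForm (Literature.NumberTheory.Automorphic.probHaarRelNormOneQuot (𝕏).K (𝕏).L) ((𝕏).P i).kernelDatum_thetaLinear Sit.κ j.1 j.2 Sit.ι Sit.hι f ∈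
        Sit.thetaForms ((𝕏).P i).weightFunctions := Submodule.subset_span ⟨j, hj, f, hf, rfl⟩
    obtain ⟨G', hG', hG'eq⟩ := htransl Γ' Γ i Sit kf hadm hK _ hθ
    have : (quotU V).rTranslate₂ F (regimeEquivT V hV ((cmAdelicProdEquiv (L : Type) 3 V.Hm).symm (1, kf⁻¹))) = G' := by
      apply Subtype.ext
      rw [hG'eq, QuotientModel.coe_rTranslate₂, hF]
    rw [this]
    exact hG'
  descend Γ i G hG := by
    -- a classical form `F ∈ Θ_i(Γ) ∩ Hol` with `F = G ∘ ιinf`, by span induction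
    have key : ∀ G ∈ Submodule.span ℂ (thetaGen hHD hI h₁ h₃ S V c hV Γ i (adm Γ i)),
        ∃ F : weightForms ((𝕏).Δ Γ) (𝕏).κ₁ (𝕏).τ₁, F ∈ (𝕏).Θ i Γ ∧ F ∈ ((𝕏).D Γ).Hol ∧
          (F : (𝕏).G₁ → (𝕏).W) = (G : (quotU V).G → (Fin 2 → ℂ)) ∘ ((𝕏).ιinf Γ) := by
      intro G hG
      induction hG using Submodule.span_induction with
      | mem x hx =>
        obtain ⟨Sit, hadm, j, hj, f, hf, hx⟩ := hx
        have hθ : ((𝕏).P i).kernelDatum.thetaForm (Literature.NumberTheory.Automorphic.probHaarRelNormOneQuot (𝕏).K (𝕏).L) ((𝕏).P i).kernelDatum_thetaLinear Sit.κ j.1 j.2 Sit.ι Sit.hι f ∈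
            Sit.thetaForms ((𝕏).P i).weightFunctions := Submodule.subset_span ⟨j, hj, f, hf, rfl⟩
        refine ⟨restrictHom ((𝕏).ιinf Γ) Sit.hΔ Sit.hη _, hΘge Γ i Sit hadm (Sit.restrictHom_mem_forms hθ),
          hhol Γ i Sit hadm _ hθ, ?_⟩
        rw [hx]
        rfl
      | zero => exact ⟨0, Submodule.zero_mem _, Submodule.zero_mem _, rfl⟩
      | add x y _ _ hx hy =>
        obtain ⟨F₁, h₁Θ, h₁H, h₁E⟩ := hx
        obtain ⟨F₂, h₂Θ, h₂H, h₂E⟩ := hy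
        refine ⟨F₁ + F₂, Submodule.add_mem _ h₁Θ h₂Θ, Submodule.add_mem _ h₁H h₂H, ?_⟩
        rw [Submodule.coe_add, Submodule.coe_add, h₁E, h₂E]
        rfl
      | smul r x _ hx =>
        obtain ⟨F, hΘ, hH, hE⟩ := hx
        refine ⟨r • F, Submodule.smul_mem _ r hΘ, Submodule.smul_mem _ r hH, ?_⟩
        rw [Submodule.coe_smul, Submodule.coe_smul, hE]
        rfl
    obtain ⟨F, hFΘ, hFH, hFE⟩ := key G hG
    obtain ⟨cl, hcl⟩ := ((𝕏).D Γ).descends F hFH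
    refine ⟨cl, ?_, ?_⟩
    · rw [Gen12Junctions.theta_eq (hV := hV)]
      refine mem_thetaClasses_of_pull_eq (MonoidHom.id _) ((𝕏).D Γ) hFΘ ?_ ?_
      · convert hFH using 1
        exact Subtype.ext rfl
      · rw [hcl]
        exact Subtype.ext rfl
    · rw [hcl]
      exact hFE

end Model

end HodgeCM

end
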